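import Summits.RiemannHypothesis.RiemannHypothesis.Theorems.WeilTwoPrimeDeflC83XBase
import Summits.RiemannHypothesis.RiemannHypothesis.Theorems.WeilTwoPrimeDeflC83XDataPE30
import Summits.RiemannHypothesis.RiemannHypothesis.Theorems.WeilTwoPrimeDeflC83XDataDnSE6
import Literature.NumberTheory.LFunctions.WeilBlockRowsPZ
import Literature.NumberTheory.LFunctions.WeilBlockRowsFast
import HarnessLib

/-!
# Deflated two-prime certificate C83X: dominance of rows 52, 53, 54, 55, 56, 57, 58, 59 of `R = S''_even(κ') − UᵀU` (rescaled factored data, 8 rows packed)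

`WeilCert.checkDomRowPZ` with the materialized augmented block, the COLUMN-RESCALED factored inverse `weilCertDeflC83XDnSE/weilCertDeflC83XLsSE` and the Bessel block, by `decide +kernel` row by row via the fast row `checkDomRowF`. Reason (prover B g9, kernel-cost lever, farm-measured 2026-08-23): Lean hashes a `Nat` literal by its low 64 bits and 5 400 of the 9 316 entries of the original factored inverse are divisible by `2^64`, so every kernel cache holding them degenerates (one dominance row ≈ 230 s); the column-rescaled rows (`v₂ ≤ 7`, pairwise distinct low words) traverse in seconds and the dominance rows pack ~10 per file. Pure proof file.
-/

set_option linter.dupNamespace false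
set_option Elab.async false

noncomputable section

namespace Summit.RiemannHypothesis.RiemannHypothesis.Theorems.EvenWinsBeyondArch

open Literature.NumberTheory.LFunctions

set_option maxHeartbeats 0 in
/-- Kernel check of the dominance of row 52 of `R` (even block, certificate C83X; rescaled factorisation `DnS/LsS`). [folklore] -/
theorem checkDomRowFS0_52_weilCertDeflC83X :
    weilCertDeflC83XBase.checkDomRowF weilCertDeflC83XPmE weilCertDeflC83XDnSE weilCertDeflC83XLsSE weilCertDeflC83XHpE weilCertDeflC83XKappa' 0 52 = true := by
  decide +kernel

/-- Dominance of row 52 of `R` (even block, rescaled factored data), from the fast row. [folklore] -/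
theorem checkDomRowPZS0_52_weilCertDeflC83X :
    weilCertDeflC83XBase.checkDomRowPZ weilCertDeflC83XPmE weilCertDeflC83XDnSE weilCertDeflC83XLsSE weilCertDeflC83XHpE weilCertDeflC83XKappa' 0 52 = true :=
  WeilCert.checkDomRowPZ_of_F (by decide) checkDomRowFS0_52_weilCertDeflC83X

set_option maxHeartbeats 0 in
/-- Kernel check of the dominance of row 53 of `R` (even block, certificate C83X; rescaled factorisation `DnS/LsS`). [folklore] -/
theorem checkDomRowFS0_53_weilCertDeflC83X :
    weilCertDeflC83XBase.checkDomRowF weilCertDeflC83XPmE weilCertDeflC83XDnSE weilCertDeflC83XLsSE weilCertDeflC83XHpE weilCertDeflC83XKappa' 0 53 = true := by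
  decide +kernel

/-- Dominance of row 53 of `R` (even block, rescaled factored data), from the fast row. [folklore] -/
theorem checkDomRowPZS0_53_weilCertDeflC83X :
    weilCertDeflC83XBase.checkDomRowPZ weilCertDeflC83XPmE weilCertDeflC83XDnSE weilCertDeflC83XLsSE weilCertDeflC83XHpE weilCertDeflC83XKappa' 0 53 = true :=
  WeilCert.checkDomRowPZ_of_F (by decide) checkDomRowFS0_53_weilCertDeflC83X

set_option maxHeartbeats 0 in
/-- Kernel check of the dominance of row 54 of `R` (even block, certificate C83X; rescaled factorisation `DnS/LsS`). [folklore] -/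
theorem checkDomRowFS0_54_weilCertDeflC83X :
    weilCertDeflC83XBase.checkDomRowF weilCertDeflC83XPmE weilCertDeflC83XDnSE weilCertDeflC83XLsSE weilCertDeflC83XHpE weilCertDeflC83XKappa' 0 54 = true := by
  decide +kernel

/-- Dominance of row 54 of `R` (even block, rescaled factored data), from the fast row. [folklore] -/
theorem checkDomRowPZS0_54_weilCertDeflC83X :
    weilCertDeflC83XBase.checkDomRowPZ weilCertDeflC83XPmE weilCertDeflC83XDnSE weilCertDeflC83XLsSE weilCertDeflC83XHpE weilCertDeflC83XKappa' 0 54 = true :=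
  WeilCert.checkDomRowPZ_of_F (by decide) checkDomRowFS0_54_weilCertDeflC83X

set_option maxHeartbeats 0 in
/-- Kernel check of the dominance of row 55 of `R` (even block, certificate C83X; rescaled factorisation `DnS/LsS`). [folklore] -/
theorem checkDomRowFS0_55_weilCertDeflC83X :
    weilCertDeflC83XBase.checkDomRowF weilCertDeflC83XPmE weilCertDeflC83XDnSE weilCertDeflC83XLsSE weilCertDeflC83XHpE weilCertDeflC83XKappa' 0 55 = true := by
  decide +kernel

/-- Dominance of row 55 of `R` (even block, rescaled factored data), from the fast row. [folklore] -/
theorem checkDomRowPZS0_55_weilCertDeflC83X :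
    weilCertDeflC83XBase.checkDomRowPZ weilCertDeflC83XPmE weilCertDeflC83XDnSE weilCertDeflC83XLsSE weilCertDeflC83XHpE weilCertDeflC83XKappa' 0 55 = true :=
  WeilCert.checkDomRowPZ_of_F (by decide) checkDomRowFS0_55_weilCertDeflC83X

set_option maxHeartbeats 0 in
/-- Kernel check of the dominance of row 56 of `R` (even block, certificate C83X; rescaled factorisation `DnS/LsS`). [folklore] -/
theorem checkDomRowFS0_56_weilCertDeflC83X :
    weilCertDeflC83XBase.checkDomRowF weilCertDeflC83XPmE weilCertDeflC83XDnSE weilCertDeflC83XLsSE weilCertDeflC83XHpE weilCertDeflC83XKappa' 0 56 = true := by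
  decide +kernel

/-- Dominance of row 56 of `R` (even block, rescaled factored data), from the fast row. [folklore] -/
theorem checkDomRowPZS0_56_weilCertDeflC83X :
    weilCertDeflC83XBase.checkDomRowPZ weilCertDeflC83XPmE weilCertDeflC83XDnSE weilCertDeflC83XLsSE weilCertDeflC83XHpE weilCertDeflC83XKappa' 0 56 = true :=
  WeilCert.checkDomRowPZ_of_F (by decide) checkDomRowFS0_56_weilCertDeflC83X

set_option maxHeartbeats 0 in
/-- Kernel check of the dominance of row 57 of `R` (even block, certificate C83X; rescaled factorisation `DnS/LsS`). [folklore] -/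
theorem checkDomRowFS0_57_weilCertDeflC83X :
    weilCertDeflC83XBase.checkDomRowF weilCertDeflC83XPmE weilCertDeflC83XDnSE weilCertDeflC83XLsSE weilCertDeflC83XHpE weilCertDeflC83XKappa' 0 57 = true := by
  decide +kernel

/-- Dominance of row 57 of `R` (even block, rescaled factored data), from the fast row. [folklore] -/
theorem checkDomRowPZS0_57_weilCertDeflC83X :
    weilCertDeflC83XBase.checkDomRowPZ weilCertDeflC83XPmE weilCertDeflC83XDnSE weilCertDeflC83XLsSE weilCertDeflC83XHpE weilCertDeflC83XKappa' 0 57 = true :=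
  WeilCert.checkDomRowPZ_of_F (by decide) checkDomRowFS0_57_weilCertDeflC83X

set_option maxHeartbeats 0 in
/-- Kernel check of the dominance of row 58 of `R` (even block, certificate C83X; rescaled factorisation `DnS/LsS`). [folklore] -/
theorem checkDomRowFS0_58_weilCertDeflC83X :
    weilCertDeflC83XBase.checkDomRowF weilCertDeflC83XPmE weilCertDeflC83XDnSE weilCertDeflC83XLsSE weilCertDeflC83XHpE weilCertDeflC83XKappa' 0 58 = true := by
  decide +kernel

/-- Dominance of row 58 of `R` (even block, rescaled factored data), from the fast row. [folklore] -/
theorem checkDomRowPZS0_58_weilCertDeflC83X :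
    weilCertDeflC83XBase.checkDomRowPZ weilCertDeflC83XPmE weilCertDeflC83XDnSE weilCertDeflC83XLsSE weilCertDeflC83XHpE weilCertDeflC83XKappa' 0 58 = true :=
  WeilCert.checkDomRowPZ_of_F (by decide) checkDomRowFS0_58_weilCertDeflC83X

set_option maxHeartbeats 0 in
/-- Kernel check of the dominance of row 59 of `R` (even block, certificate C83X; rescaled factorisation `DnS/LsS`). [folklore] -/
theorem checkDomRowFS0_59_weilCertDeflC83X :
    weilCertDeflC83XBase.checkDomRowF weilCertDeflC83XPmE weilCertDeflC83XDnSE weilCertDeflC83XLsSE weilCertDeflC83XHpE weilCertDeflC83XKappa' 0 59 = true := by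
  decide +kernel

/-- Dominance of row 59 of `R` (even block, rescaled factored data), from the fast row. [folklore] -/
theorem checkDomRowPZS0_59_weilCertDeflC83X :
    weilCertDeflC83XBase.checkDomRowPZ weilCertDeflC83XPmE weilCertDeflC83XDnSE weilCertDeflC83XLsSE weilCertDeflC83XHpE weilCertDeflC83XKappa' 0 59 = true :=
  WeilCert.checkDomRowPZ_of_F (by decide) checkDomRowFS0_59_weilCertDeflC83X

end Summit.RiemannHypothesis.RiemannHypothesis.Theorems.EvenWinsBeyondArch
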